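import Summits.CriticalPhenomena.Ising3DConformalLimit.Theses.EnergyNotSigmaSquared
import Summits.CriticalPhenomena.Ising3DConformalLimit.Theses.IsingEuclidUpgrade
import Summits.CriticalPhenomena.Ising3DConformalLimit.Theses.BallOrbitComparison
import Literature.Barriers.CriticalPhenomena.BootstrapLatticeBlindness

/-!
# Sketch — crux stmt-CriticalPhenomena-1344 `MoebiusLimitExists`, crux-ideate round 1 (ideator 1)

First lemmas of the two idea cards (elaboration only; proofs are not required at this stage):

* card `invert-the-cluster-points`: `rhoPin`, `IsClusterPoint`, `pinned_iff` (A1),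
  `moebiusLimitExists_of_clusterPoints` (A2);
* card `only-interaction-breaks-moebius`: `moebius_of_u4_free_clusterPoint` (C1),
  `moebiusLimitExists_of_free_branch` (C2), `interaction_of_not_moebiusLimit` (C3).
-/

noncomputable section

open Filter Topology
open Literature.Probability.LatticeModels

namespace Summit.CriticalPhenomena.Ising3DConformalLimit.Cruxes.MoebiusLimitExists.Sketch

/-- The PINNED renormalisation `ρ_pin(δ) := ⟨σ₀ σ_{⌊1/δ⌋ e₁}⟩_{β_c}^{-1/2}`: with it every
subsequential limit has `S 2 (0, e₁) = 1`, so no killing / exploding renormalisation occurs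
(cf. `Theorems/IsingCFTDataRefutations.lean`). -/
def rhoPin (δ : ℝ) : ℝ :=
  (criticalTwoPoint 3 (Pi.single 0 (⌊1 / δ⌋ : ℤ))) ^ (-(1 / 2 : ℝ))

/-- `S` is a CLUSTER POINT of the pinned zoom: along some mesh sequence `u k → 0⁺` the pinned
rescaled critical correlators converge to `S n` locally uniformly on non-coincident
configurations, for every `n` (one sequence for all `n`). -/
def IsClusterPoint (S : CorrFamily 3) : Prop :=
  ∃ u : ℕ → ℝ, Tendsto u atTop (𝓝[>] (0 : ℝ)) ∧
    ∀ n, TendstoLocallyUniformlyOn (fun k => rescaledCorrelator (criticalCorr 3) rhoPin n (u k))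
      (S n) atTop (NonCoincident 3 n)

/-- (A1, pinning) The crux is equivalent to its pinned form: `∃ ρ` is not a degree of freedom.
(`→`: `ρ(δ)² G(⌊1/δ⌋e₁) → S 2 (0,e₁) =: c > 0`, so `ρ_pin/ρ → c^{-1/2}` and `c^{-n/2} S n` is the
pinned limit; `←`: `ρ_pin > 0` on `(0,1]` by `criticalTwoPoint_bounds`.) -/
theorem pinned_iff :
    Summit.CriticalPhenomena.Ising3DConformalLimit.Theses.EnergyNotSigmaSquared.MoebiusLimit ↔
      ∃ (Δ : ℝ) (S : CorrFamily 3), 0 < Δ ∧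
        HasPointwiseScalingLimit (criticalCorr 3) rhoPin S ∧ IsNondegenerateTwoPoint S ∧
          IsMoebiusCovariant Δ S := by
  sorry

/-- (A2, the crux from its cluster points) COMPACTNESS of the pinned zoom (every mesh sequence
has a subsequence along which all `n`-point families converge off the diagonals) +
INVERSION COVARIANCE, translation invariance and non-degeneracy of every cluster point +
UNIQUENESS of cluster points off the diagonals + the word lemma (item stmt-4726) give the crux,
via the in-tree subsequence principle `hasPointwiseScalingLimit_of_seq_subseq`. -/
theorem moebiusLimitExists_of_clusterPoints
    (hcompact : ∀ u : ℕ → ℝ, Tendsto u atTop (𝓝[>] (0 : ℝ)) →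
      ∃ (φ : ℕ → ℕ) (S : CorrFamily 3), StrictMono φ ∧
        ∀ n, TendstoLocallyUniformlyOn
          (fun k => rescaledCorrelator (criticalCorr 3) rhoPin n (u (φ k))) (S n) atTop
          (NonCoincident 3 n))
    (hinv : ∀ S : CorrFamily 3, IsClusterPoint S → (∀ n z, z ∉ NonCoincident 3 n → S n z = 0) →
      ∃ Δ : ℝ, 0 < Δ ∧ IsTranslationInvariant S ∧ IsInversionCovariant Δ S ∧
        IsNondegenerateTwoPoint S)
    (huniq : ∀ S₁ S₂ : CorrFamily 3, IsClusterPoint S₁ → IsClusterPoint S₂ →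
      ∀ n, (NonCoincident 3 n).EqOn (S₁ n) (S₂ n))
    (hword : Summit.CriticalPhenomena.Ising3DConformalLimit.Theses.BallOrbitComparison.MoebiusOfTranslationInversion) :
    Summit.CriticalPhenomena.Ising3DConformalLimit.Theses.EnergyNotSigmaSquared.MoebiusLimit := by
  sorry

/-- (C1, only interaction can break Möbius) A NORMALISED cluster point of the pinned zoom whose
connected four-point function vanishes off the diagonals is the Wick family of its two-point
function; given the two-point law (item stmt-0634, verbatim) it is therefore Möbius covariant with
`Δ` the two-point exponent. Engine: Newman's Lee–Yang Gaussianity for the block spins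
`Φ_δ(f) = δ³ ρ_pin(δ) Σ f(δx) σ_x` (`u₄ → 0` off-diagonal by hypothesis, diagonal terms are
`O(δ³ρ_pin²) + O(δ⁶)`, sub-Gaussian tails by `E e^{tΦ} ≤ e^{t² EΦ²/2}`), then joint Gaussianity
kills every `U_{2k}` off the diagonals. -/
theorem moebius_of_u4_free_clusterPoint
    (h2pt : Summit.CriticalPhenomena.Ising3DConformalLimit.Theses.IsingEuclidUpgrade.IsingEuclidUpgradeR2RotInvPowerLaw)
    (S : CorrFamily 3) (hS : IsClusterPoint S)
    (h0 : ∀ n z, z ∉ NonCoincident 3 n → S n z = 0) (hfree : ¬ HasNontrivialU4 S) :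
    ∃ Δ : ℝ, 0 < Δ ∧ IsNondegenerateTwoPoint S ∧ IsMoebiusCovariant Δ S ∧
      ∀ x ∈ NonCoincident 3 2, S 2 x = ‖x 0 - x 1‖ ^ (-(2 * Δ)) := by
  sorry

/-- (C2, the free branch of the crux IS the two-point problem) If the two-point law holds and every
cluster point of the pinned zoom is `U₄`-free, then all cluster points coincide with ONE Wick
family, the pinned zoom converges (subsequence principle), and the crux holds — existence included.
Compactness is as in (A2). -/
theorem moebiusLimitExists_of_free_branch
    (h2pt : Summit.CriticalPhenomena.Ising3DConformalLimit.Theses.IsingEuclidUpgrade.IsingEuclidUpgradeR2RotInvPowerLaw)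
    (hcompact : ∀ u : ℕ → ℝ, Tendsto u atTop (𝓝[>] (0 : ℝ)) →
      ∃ (φ : ℕ → ℕ) (S : CorrFamily 3), StrictMono φ ∧
        ∀ n, TendstoLocallyUniformlyOn
          (fun k => rescaledCorrelator (criticalCorr 3) rhoPin n (u (φ k))) (S n) atTop
          (NonCoincident 3 n))
    (hfree : ∀ S : CorrFamily 3, IsClusterPoint S → ¬ HasNontrivialU4 S) :
    Summit.CriticalPhenomena.Ising3DConformalLimit.Theses.EnergyNotSigmaSquared.MoebiusLimit := by
  sorry

/-- (C3, contrapositive reading) Given the two-point law and compactness, FAILURE of the crux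
certifies interaction: some cluster point of the pinned zoom has a non-trivial connected
four-point function. -/
theorem interaction_of_not_moebiusLimit
    (h2pt : Summit.CriticalPhenomena.Ising3DConformalLimit.Theses.IsingEuclidUpgrade.IsingEuclidUpgradeR2RotInvPowerLaw)
    (hcompact : ∀ u : ℕ → ℝ, Tendsto u atTop (𝓝[>] (0 : ℝ)) →
      ∃ (φ : ℕ → ℕ) (S : CorrFamily 3), StrictMono φ ∧
        ∀ n, TendstoLocallyUniformlyOn
          (fun k => rescaledCorrelator (criticalCorr 3) rhoPin n (u (φ k))) (S n) atTop
          (NonCoincident 3 n))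
    (hnot : ¬ Summit.CriticalPhenomena.Ising3DConformalLimit.Theses.EnergyNotSigmaSquared.MoebiusLimit) :
    ∃ S : CorrFamily 3, IsClusterPoint S ∧ HasNontrivialU4 S := by
  classical
  by_contra h
  simp only [not_exists, not_and] at h
  exact hnot (moebiusLimitExists_of_free_branch h2pt hcompact fun S hS => h S hS)

end Summit.CriticalPhenomena.Ising3DConformalLimit.Cruxes.MoebiusLimitExists.Sketch

end
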